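import Summits.QuantumAdvantage.QuantumAdvantage.Theses.WhiteBoxWalk
import Summits.QuantumAdvantage.QuantumAdvantage.Theorems.WbwVerifiableLineNoSpeedup.Negative.LoadBearing
import Summits.QuantumAdvantage.QuantumAdvantage.Theorems.WbwVerifiableLineNoSpeedup.Negative.Tightness
import Summits.QuantumAdvantage.QuantumAdvantage.Theorems.WhiteBoxWalkWbwVerifiableLineNoSpeedupCycleSurgeryDefs
import Summits.QuantumAdvantage.QuantumAdvantage.Theorems.WhiteBoxWalkWbwVerifiableLineNoSpeedupCycleSurgeryAdversaryDefs
import Summits.QuantumAdvantage.QuantumAdvantage.Theorems.WhiteBoxWalkWbwVerifiableLineNoSpeedupCycleSurgeryAnatomy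
import Summits.QuantumAdvantage.QuantumAdvantage.Theorems.WhiteBoxWalkWbwVerifiableLineNoSpeedupCycleSurgeryPartner
import Summits.QuantumAdvantage.QuantumAdvantage.Theorems.WhiteBoxWalkWbwVerifiableLineNoSpeedupCycleSurgeryGoodSet
import Summits.QuantumAdvantage.QuantumAdvantage.Theorems.WhiteBoxWalkWbwVerifiableLineNoSpeedupCycleSurgeryDegrees
import Summits.QuantumAdvantage.QuantumAdvantage.Theorems.WhiteBoxWalkWbwVerifiableLineNoSpeedupRelationalAdversary
import Summits.QuantumAdvantage.QuantumAdvantage.Theorems.WhiteBoxWalkWbwVerifiableLineNoSpeedupPairProducts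
import Summits.QuantumAdvantage.QuantumAdvantage.Theorems.WhiteBoxWalkWbwVerifiableLineNoSpeedupFamilyNonempty
import Literature.Computability.QuantumComplexity.SinkOfVerifiableLine
import Literature.Computability.QuantumComplexity.ExactQuantumQuery

/-!
# THE CRUX `WhiteBoxWalk.WbwVerifiableLineNoSpeedup` (stmt-QuantumAdvantage-2239) — PROOF (final assembly
of the line `cycle-surgery-adversary`; lead prover-line-stmt-QuantumAdvantage-2239-0)

THE CRUX (`Negative.crux_iff`, `Iff.rfl`):
`∃ c > 0, ∀ m T, 2 ≤ m → 1 ≤ T → T + 1 ≤ 2^(m-1) → c · min (T+1) √(2^m) / m ≤ Q_{1/3}(SVL_{m,T})`,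
`Q_{1/3}(SVL_{m,T}) = svlQ m T = quantumQueryComplexityOn (1/3) (svlPromise m T) (svlSinkBit m T)`
(bounded-error bit-query complexity of the sink parity of black-box SINK-OF-VERIFIABLE-LINE).

THE PROOF (idea card `Ideas/cycle-surgery-adversary.md`; `c = 1/4608`): Ambainis's RELATIONAL ADVERSARY
bound in average-degree form (`stub_relationalAdversary`, file `…RelationalAdversary.lean`, a corollary of
the tree's `Negative.WeightedAdversaryBound.card_le_queries_mul` [Ambainis 2002, Thm 6]) applied to the
TWO-ROW CYCLE SURGERY relation `S' = S * swap(x_k, v)` on the prefix-pinned long-cycle permutation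
instances (`…CycleSurgeryDefs.lean`: `hid = min T 2^(m-4)`, `pre = T - hid`, family `InFamily`, relation
`rel ⊆ famX × famY`): per-pair per-bit products `≤ Lstar = max (N², 4 hid² N)` (`stub_pairProducts`,
`…PairProducts.lean`, from the anatomy `x'_{k+j} = S^j v` of `…CycleSurgeryAnatomy.lean`), min degree
`≥ dstar = hid · N / 8` on both sides (`stub_degrees`, `…CycleSurgeryDegrees.lean`, from
`stub_partnerFamily` — merge and far-split partners stay in the family, `…CycleSurgeryPartner.lean` —,
the parity count `stub_goodSetCard`, `…CycleSurgeryGoodSet.lean`, and nonemptiness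
`stub_familyNonempty`, `…FamilyNonempty.lean`); hence `dstar ≤ 144 · Q · √Lstar`, i.e.
`Q ≥ min(hid/8, √N/16)/144 ≥ min(T+1, √N)/4608` for `m ≥ 10`, and `Q ≥ 1` (`Negative.one_le_svlQ_of_hyps`)
covers `m ≤ 9`; dividing by `m ≥ 1` only weakens. Every ingredient is a landed, sorry-free theorem; this
file is the composition (the registered skeleton `Lines/cycle-surgery-adversary.lean` with its six stubs
replaced by imports).
-/

noncomputable section

set_option linter.dupNamespace false

namespace Summit.QuantumAdvantage.QuantumAdvantage.Theorems.WbwVerifiableLineNoSpeedup.CycleSurgery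

open Literature.Computability.Cryptography Literature.Computability.QuantumComplexity
  Literature.Computability.Complexity
open Summit.QuantumAdvantage.QuantumAdvantage.Theses.WhiteBoxWalk (WbwVerifiableLineNoSpeedup)
open Summit.QuantumAdvantage.QuantumAdvantage.Theorems.WbwVerifiableLineNoSpeedup.Negative

/-! ## Composition (all six former stubs are imported theorems) -/

section Composition

/-- `|R| ≥ d · |X|` from a left min-degree bound (fibrewise counting). -/
theorem card_mul_le_of_leftDeg {n : ℕ} {X : Finset (Fin n → Bool)}
    {R : Finset ((Fin n → Bool) × (Fin n → Bool))} {d : ℝ}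
    (hmaps : ∀ p ∈ R, p.1 ∈ X) (hdeg : ∀ t ∈ X, d ≤ (leftDeg R t : ℝ)) :
    d * X.card ≤ (R.card : ℝ) := by
  have hfib : R.card = ∑ t ∈ X, leftDeg R t :=
    Finset.card_eq_sum_card_fiberwise (f := Prod.fst) (s := R) (t := X) fun p hp => hmaps p hp
  rw [hfib, Nat.cast_sum]
  calc d * X.card = ∑ t ∈ X, d := by rw [Finset.sum_const, nsmul_eq_mul, mul_comm]
    _ ≤ ∑ t ∈ X, (leftDeg R t : ℝ) := Finset.sum_le_sum fun t ht => hdeg t ht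

/-- `|R| ≥ d · |Y|` from a right min-degree bound. -/
theorem card_mul_le_of_rightDeg {n : ℕ} {Y : Finset (Fin n → Bool)}
    {R : Finset ((Fin n → Bool) × (Fin n → Bool))} {d : ℝ}
    (hmaps : ∀ p ∈ R, p.2 ∈ Y) (hdeg : ∀ t ∈ Y, d ≤ (rightDeg R t : ℝ)) :
    d * Y.card ≤ (R.card : ℝ) := by
  have hfib : R.card = ∑ t ∈ Y, rightDeg R t :=
    Finset.card_eq_sum_card_fiberwise (f := Prod.snd) (s := R) (t := Y) fun p hp => hmaps p hp
  rw [hfib, Nat.cast_sum]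
  calc d * Y.card = ∑ t ∈ Y, d := by rw [Finset.sum_const, nsmul_eq_mul, mul_comm]
    _ ≤ ∑ t ∈ Y, (rightDeg R t : ℝ) := Finset.sum_le_sum fun t ht => hdeg t ht

/-- The abstract adversary inequality: if `d|X| ≤ |R|`, `d|Y| ≤ |R|`, `|R| ≤ K √(|X||Y|)` with `X, Y`
nonempty and `d, K ≥ 0`, then `d ≤ K`. -/
theorem le_of_degrees {d K X Y R : ℝ} (hd : 0 ≤ d) (hK : 0 ≤ K) (hX : 0 < X) (hY : 0 < Y)
    (h1 : d * X ≤ R) (h2 : d * Y ≤ R) (h3 : R ≤ K * Real.sqrt (X * Y)) : d ≤ K := by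
  have hR : 0 ≤ R := le_trans (by positivity) h1
  have hsq : Real.sqrt (X * Y) ^ 2 = X * Y := Real.sq_sqrt (by positivity)
  have h4 : (d * X) * (d * Y) ≤ R * R := mul_le_mul h1 h2 (by positivity) hR
  have h5 : R ^ 2 ≤ (K * Real.sqrt (X * Y)) ^ 2 := pow_le_pow_left₀ hR h3 2
  rw [mul_pow, hsq] at h5
  have h6 : d ^ 2 * (X * Y) ≤ K ^ 2 * (X * Y) := by nlinarith
  have h7 : d ^ 2 ≤ K ^ 2 := le_of_mul_le_mul_right h6 (by positivity)
  exact (sq_le_sq₀ hd hK).1 h7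

/-- **The combinatorial–analytic core**: the `1/m`-free bound `c · min (T+1) √(2^m) ≤ Q`, `c = 1/4608`,
from the adversary stub, the product stub and the min-degree statement. -/
theorem cruxShape_of_parts (hA : type_of% stub_relationalAdversary) (hB : type_of% stub_pairProducts)
    (hC : ∀ m T : ℕ, 4 ≤ m → 1 ≤ T → T + 1 ≤ 2 ^ (m - 1) →
      (famX m T).Nonempty ∧ (famY m T).Nonempty ∧
        (∀ t ∈ famX m T, dstar m T ≤ (leftDeg (rel m T) t : ℝ)) ∧
          ∀ t ∈ famY m T, dstar m T ≤ (rightDeg (rel m T) t : ℝ)) :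
    ∀ m T : ℕ, 2 ≤ m → 1 ≤ T → T + 1 ≤ 2 ^ (m - 1) →
      (1 / 4608 : ℝ) * min ((T : ℝ) + 1) (Real.sqrt (2 ^ m)) ≤ (svlQ m T : ℝ) := by
  intro m T hm hT hTm
  have hQ1 : (1 : ℝ) ≤ (svlQ m T : ℝ) := by exact_mod_cast one_le_svlQ_of_hyps hT hTm
  have hNpos : (0 : ℝ) < 2 ^ m := by positivity
  have hsqN : 0 < Real.sqrt (2 ^ m) := Real.sqrt_pos.2 hNpos
  by_cases hm10 : 10 ≤ m
  · -- MAIN CASE `m ≥ 10`: Ambainis on the surgery relation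
    have hm4 : 4 ≤ m := le_trans (by norm_num) hm10
    obtain ⟨A, hAq, hAc⟩ := exists_queries_eq_quantumQueryComplexityOn
      (N := 2 ^ m * m + 2 ^ m * (T + 1)) (ε := 1 / 3) (by norm_num) (svlPromise m T) (svlSinkBit m T)
    obtain ⟨hXne, hYne, hdX, hdY⟩ := hC m T hm4 hT hTm
    have hWF := rel_wellFormed m T
    have hRWF : RelWellFormed (svlPromise m T) (svlSinkBit m T) (famX m T) (famY m T) (rel m T) := by
      intro p hp
      obtain ⟨h1, h2, h3, h4, h5, h6⟩ := hWF p hp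
      refine ⟨h1, h2, h3, h4, ?_⟩
      rw [h5, h6]
      decide
    have hmain := hA (2 ^ m * m + 2 ^ m * (T + 1)) A (svlPromise m T) (svlSinkBit m T) hAc
      (famX m T) (famY m T) (rel m T) (Lstar m T) hRWF (hB m T hm4 hT hTm)
    rw [hAq] at hmain
    have hRX : dstar m T * (famX m T).card ≤ ((rel m T).card : ℝ) :=
      card_mul_le_of_leftDeg (fun p hp => (hWF p hp).1) hdX
    have hRY : dstar m T * (famY m T).card ≤ ((rel m T).card : ℝ) :=
      card_mul_le_of_rightDeg (fun p hp => (hWF p hp).2.1) hdY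
    have hXpos : (0 : ℝ) < (famX m T).card := by exact_mod_cast hXne.card_pos
    have hYpos : (0 : ℝ) < (famY m T).card := by exact_mod_cast hYne.card_pos
    have hd0 : 0 ≤ dstar m T := by unfold dstar; positivity
    have hkey : dstar m T ≤ 144 * (svlQ m T : ℝ) * Real.sqrt (Lstar m T) :=
      le_of_degrees hd0 (by positivity) hXpos hYpos hRX hRY hmain
    set q : ℝ := (svlQ m T : ℝ) with hq
    have hq0 : 0 ≤ q := by positivity
    have hhid1 : 1 ≤ hid m T := le_min hT Nat.one_le_two_pow
    have hhidR : (1 : ℝ) ≤ (hid m T : ℝ) := by exact_mod_cast hhid1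
    have hhidpos : (0 : ℝ) < (hid m T : ℝ) := by linarith
    set s : ℝ := Real.sqrt (2 ^ m) with hs
    have hss : s * s = 2 ^ m := Real.mul_self_sqrt hNpos.le
    -- `min (T+1) √N ≤ 4 · hid`
    have hmin4 : min ((T : ℝ) + 1) s ≤ 4 * (hid m T : ℝ) := by
      by_cases hTm4 : T ≤ 2 ^ (m - 4)
      · have hh : hid m T = T := min_eq_left hTm4
        rw [hh]
        have hT1 : (1 : ℝ) ≤ T := by exact_mod_cast hT
        calc min ((T : ℝ) + 1) s ≤ (T : ℝ) + 1 := min_le_left _ _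
          _ ≤ 4 * (T : ℝ) := by linarith
      · have hh : hid m T = 2 ^ (m - 4) := min_eq_right (le_of_lt (Nat.lt_of_not_le hTm4))
        rw [hh]
        push_cast
        have h4 : (4 : ℝ) * 2 ^ (m - 4) = 2 ^ (m - 2) := by
          rw [show (4 : ℝ) = 2 ^ 2 by norm_num, ← pow_add]
          congr 1
          omega
        rw [h4]
        calc min ((T : ℝ) + 1) s ≤ s := min_le_right _ _
          _ ≤ 2 ^ (m - 2) := by
            rw [hs, Real.sqrt_le_left (by positivity), ← pow_mul]
            exact pow_le_pow_right₀ (by norm_num) (by omega)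
    unfold dstar Lstar at hkey
    rcases le_total ((2 : ℝ) ^ m * 2 ^ m) (4 * (hid m T : ℝ) ^ 2 * 2 ^ m) with hle | hle
    · -- Grover branch: `L* = 4 hid² N`, `√L* = 2 · hid · √N`
      rw [max_eq_right hle] at hkey
      have hsqrtL : Real.sqrt (4 * (hid m T : ℝ) ^ 2 * 2 ^ m) = 2 * (hid m T : ℝ) * s := by
        rw [show (4 : ℝ) * (hid m T : ℝ) ^ 2 * 2 ^ m = (2 * (hid m T : ℝ)) ^ 2 * 2 ^ m by ring,
          Real.sqrt_mul (by positivity), Real.sqrt_sq (by positivity)]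
      rw [hsqrtL, ← hss] at hkey
      have h1 : s ≤ 2304 * q := by
        nlinarith [mul_pos hhidpos hsqN, hkey]
      calc (1 / 4608 : ℝ) * min ((T : ℝ) + 1) s ≤ (1 / 4608) * s := by
            gcongr
            exact min_le_right _ _
        _ ≤ q := by linarith
    · -- walk branch: `L* = N²`, `√L* = N`
      rw [max_eq_left hle] at hkey
      have hsqrtL : Real.sqrt ((2 : ℝ) ^ m * 2 ^ m) = 2 ^ m := Real.sqrt_mul_self hNpos.le
      rw [hsqrtL] at hkey
      have h1 : (hid m T : ℝ) ≤ 1152 * q := by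
        nlinarith [hNpos, hkey]
      calc (1 / 4608 : ℝ) * min ((T : ℝ) + 1) s ≤ (1 / 4608) * (4 * (hid m T : ℝ)) := by
            gcongr
        _ ≤ q := by linarith
  · -- SMALL CASE `m ≤ 9`: `c · min ≤ √(2^9)/4608 < 1 ≤ Q`
    have hsqrt : Real.sqrt (2 ^ m) ≤ 32 := by
      rw [Real.sqrt_le_left (by norm_num)]
      calc (2 : ℝ) ^ m ≤ 2 ^ 10 := pow_le_pow_right₀ (by norm_num) (by omega)
        _ = 32 ^ 2 := by norm_num
    calc (1 / 4608 : ℝ) * min ((T : ℝ) + 1) (Real.sqrt (2 ^ m)) ≤ (1 / 4608) * 32 := by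
          gcongr
          exact (min_le_right _ _).trans hsqrt
      _ ≤ 1 := by norm_num
      _ ≤ _ := hQ1

/-- **The crux from the six stubs' TYPES** (transfer `C⁺ → crux`: dividing by `m ≥ 1` only weakens;
`Negative.crux_iff` is `Iff.rfl`). -/
theorem WbwVerifiableLineNoSpeedup_of_parts (hA : type_of% stub_relationalAdversary)
    (hB : type_of% stub_pairProducts) (hP : type_of% stub_partnerFamily)
    (hG : type_of% stub_goodSetCard) (hN : type_of% stub_familyNonempty)
    (hD : type_of% stub_degrees) : WbwVerifiableLineNoSpeedup := by
  rw [crux_iff]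
  refine ⟨1 / 4608, by norm_num, fun m T hm hT hTm => ?_⟩
  have hm1 : (1 : ℝ) ≤ m := by exact_mod_cast le_trans (by norm_num) hm
  have key := cruxShape_of_parts hA hB (hD hP hG hN) m T hm hT hTm
  have hnn : 0 ≤ (1 / 4608 : ℝ) * min ((T : ℝ) + 1) (Real.sqrt (2 ^ m)) :=
    mul_nonneg (by norm_num) (le_min (by positivity) (Real.sqrt_nonneg _))
  exact (div_le_self hnn hm1).trans key

/-- **THE CRUX `WhiteBoxWalk.WbwVerifiableLineNoSpeedup` (stmt-QuantumAdvantage-2239), PROVED**: `Q_{1/3}` of the sink parity of black-box SVL is at least `min(T+1, √(2^m)) / (4608 m)` — Ambainis's relational adversary on the cycle-surgery relation of prefix-pinned long-cycle permutation instances. -/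
theorem WbwVerifiableLineNoSpeedup_of :
    Summit.QuantumAdvantage.QuantumAdvantage.Theses.WhiteBoxWalk.WbwVerifiableLineNoSpeedup :=
  WbwVerifiableLineNoSpeedup_of_parts stub_relationalAdversary stub_pairProducts stub_partnerFamily
    stub_goodSetCard stub_familyNonempty stub_degrees

end Composition

end Summit.QuantumAdvantage.QuantumAdvantage.Theorems.WbwVerifiableLineNoSpeedup.CycleSurgery

end
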